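/-
Copyright: lit-balaban Phase-2 proof seat p30 (gen 26).  Statement-level skeleton of a published paper; no proof claims beyond what the
kernel checks below.
-/
import Literature.MathematicalPhysics.QuantumFieldTheory.BalabanImbrieJaffe1984to88.BIJ85ScalarPropagatorSupDecayHolder

/-!
# [BalabanImbrieJaffe1985] §7.3 p. 326 — the propagators `G_k(u)` under (7.3.1) satisfy the estimates of [7]:
# **the HÖLDER member of [Balaban1983RegularityDecay] (1.9) for the covariant derivative of the torus block propagator at small
# non-flat fields, `k`-uniform — gauge-invariant form with the explicit transport, all pairs** (file 2c)

T. Bałaban, J. Imbrie, A. Jaffe, *Renormalization of the Higgs model: minimizers, propagators and the stability of mean field theory*,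
Commun. Math. Phys. **97** (1985) 299–329 [BalabanImbrieJaffe1985], §7.3 p. 326 [PDF 28] *"The propagators arising from Δ_k(u_k), under the
restriction (7.3.1) on the gauge field, also satisfy the regularity and decay estimates of [7]"*; [7] = T. Bałaban, *Regularity and decay of
lattice Green's functions*, Commun. Math. Phys. **89** (1983) 571–597 [Balaban1983RegularityDecay], Theorem p. 573, (1.9):
*"|x − x′|^{−α}|U(A(Γ_{x,x′}))(D^η_{A,μ}G_k(Ω,A)f)(x′) − (D^η_{A,μ}G_k(Ω,A)f)(x)| ≤ c₀exp(−δ₀dist({x,x′}, supp f))‖f‖_∞ … Γ_{x,x′} a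
shortest contour connecting these points"*.

statement-level skeleton of published theorems with citation tags; proofs where landed; nothing here is a claim about the Yang–Mills mass gap

CITATION HEADER (lean-in-tree rule).  Part of the lit-balaban TYPED SKELETON (HOME `run/shared/lean/pub/lit-balaban/`), PHASE-2 proof seat
p30 gen 26 (unit `lit-balaban-p30-g26`; TAKING line HOME/STATUS.md 2026-08-23T01:01:50Z; free-target protocol G.5-34(d) — the Hölder residual
of item 3 of `HOME/lit-balaban-r15/C1-CLOSURE.md` §5, owner r15).  WHAT THIS FILE IS: the ASSEMBLED (1.9) member for row **C1.Eq7.3.1-7.3.2** of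
`HOME/lit-balaban-r15/ROWS-C1.md` (a LOCATED MEMBER on ACCEPT — it completes the torus list value/`D_u`/Hölder of §5 item 3; no head change):
§1 the transport `U(Γ)` along a straight lattice segment on the torus (`axisHol`, a concrete `def`) with its gauge covariance; §2 the
gauge-invariant restatement `holder19_leg` of file 2b's `holder19_leg_gauged` (the transport along the axis is `1` in the axis-rooted gauge and
covariant derivatives are gauge covariant); §3 far pairs (`64|x−x′|_∞ > L^k`) from the `D_u` member alone; §4 general pairs: the shortest
staircase contour `Γ_{x,x′}` (one straight leg per coordinate, each the short way round the torus; `stairHol`) and the telescoping of the `d`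
legs — `holder19_smallField`: for `2 ≤ d ≤ 3`, every `0 ≤ α < 1`, `k`-uniformly at small fields,
`(L^k/|x−x′|_∞)^α·|U(Γ_{x,x′})(D_uG_k(T,u)f)(⟨x′,μ⟩) − (D_uG_k(T,u)f)(⟨x,μ⟩)| ≤ c₀(L^kε)e^{−t₀dist({x,x′},supp f)/L^k}‖f‖_∞`.  Definitions
with bodies (`axisHol`, `stairPt`, `legHol`, `stairHol`) + theorems; no `Prop` placeholder, no new fact.

HONEST SCOPE.  `2 ≤ d ≤ 3`, whole torus `Ω = T` (no Neumann sub-domains, so no `R₀`-restriction), `U(1)` fields (`BIJ88Sect3Statements.U1`),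
hypotheses of the value member p27 (`|u(∂p) − 1| ≤ θ`, `2d³(L^{2k}θ)² ≤ 1`; that (7.3.1) implies them for the background of record is p33's
`BIJ85Claim73PropagatorDecay`, not restated), constants `t₀` (on `d, L, a`) and `c₀` (on `d, L, a, α`) ours, distance in the block scale `L^k`;
the contour is OUR explicit shortest staircase (the print allows any shortest contour); ONE power of the block spacing `L^kε` on the right as in
the `D_u` member.  DIVERGENCE OF METHOD from [7]'s random-walk expansion as in gen 25 / file 2b.  Nothing here is summit progress, continuum
or Clay.  Unit `lit-balaban-p30` (literature-prover-lit-balaban-p30-g26-0), HOME `run/shared/lean/pub/lit-balaban/`, 2026-08-23.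
-/

open scoped BigOperators ComplexConjugate
open Finset Matrix

namespace Literature.MathematicalPhysics.QuantumFieldTheory.BalabanImbrieJaffe1984to88.BIJ85ScalarPropagatorHolderDecay

open Literature.MathematicalPhysics.QuantumFieldTheory.Balaban1983to89
open LatticeFieldCalculus (supDist runSite runSite_zero runSite_succ)
open B3TorusRadialSums (cdist cdist_le_supDist supDist_comm supDist_eq_sup_cdist supDist_eq_zero_iff cdist_neg cdist_eq_zero_iff)
open BIJ85Ineq722Torus (supDist_triangle supDist_runSite_le)
open BIJ88Sect3Statements (U1 toC cfg covD norm_toC toC_one toC_mul toC_inv)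
open BIJ88NeumannPropagator227Torus (gBox conj_mul_toC toC_mul_conj)
open BIJ85ScalarPropagatorSupDecayDeriv (cfg_gaugeAct_apply)
open BIJ85ScalarPropagatorSupDecayHolder (holder19_leg_gauged)

noncomputable section

/-! ## §1 The transport along a straight segment of the torus and its gauge covariance -/

section Transport

variable {P : Params} {j : ℕ} {G : Type*}

/-- **THE TRANSPORT ALONG THE STRAIGHT SEGMENT** `[x, x + te_i]` of the torus: `U(Γ) = U(x,x+e_i)U(x+e_i,x+2e_i)⋯U(x+(t−1)e_i,x+te_i)`
(the `U(A(Γ_{x,x′}))` of [Balaban1983RegularityDecay] (1.9) for an axis-parallel pair; B7 (9) *"V(Γ) = V(b₁)⋯V(b_n)"*).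
[cite: Balaban1983RegularityDecay, (1.9) p.573; Balaban1985Averaging, (9) p.18] -/
def axisHol [Monoid G] (U : GaugeField P j G) (i : Fin P.d) : ℕ → Balaban1983to89.Site P j → G
  | 0, _ => 1
  | t + 1, x => axisHol U i t x * U ⟨runSite x i t, i⟩

/-- kernel: `axisHol` at `0` and at `t+1`. [cite: Balaban1985Averaging, (9) p.18] -/
@[simp] theorem axisHol_zero [Monoid G] (U : GaugeField P j G) (i : Fin P.d) (x : Balaban1983to89.Site P j) : axisHol U i 0 x = 1 := rfl

/-- kernel: `U([x, x+(t+1)e_i]) = U([x, x+te_i])·U(x+te_i, x+(t+1)e_i)`. [cite: Balaban1985Averaging, (9) p.18] -/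
theorem axisHol_succ [Monoid G] (U : GaugeField P j G) (i : Fin P.d) (t : ℕ) (x : Balaban1983to89.Site P j) :
    axisHol U i (t + 1) x = axisHol U i t x * U ⟨runSite x i t, i⟩ := rfl

/-- kernel: the off-axis coordinates of `x + te_i` are those of `x`. [cite: Balaban1984PropagatorsI, (1.7) p.18] -/
theorem runSite_apply_ne (x : Balaban1983to89.Site P j) {i ν : Fin P.d} (h : ν ≠ i) (t : ℕ) : runSite x i t ν = x ν := by
  simp [runSite, Function.update_of_ne h]

/-- kernel: the `i`-th coordinate of `x + te_i` is `x_i + t`. [cite: Balaban1984PropagatorsI, (1.7) p.18] -/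
theorem runSite_apply_self (x : Balaban1983to89.Site P j) (i : Fin P.d) (t : ℕ) : runSite x i t i = x i + t := by
  simp [runSite]

/-- kernel: the circular distance of a small natural residue is itself: `2t ≤ n ⟹ cdist (t : ZMod n) = t`. [cite: Balaban1984PropagatorsI, (1.7) p.18] -/
theorem cdist_natCast_of_two_mul_le {n : ℕ} [NeZero n] {t : ℕ} (ht : 2 * t ≤ n) : cdist (t : ZMod n) = t := by
  have hn : 0 < n := Nat.pos_of_ne_zero (NeZero.ne n)
  rcases Nat.eq_zero_or_pos t with h0 | htpos
  · subst h0; simp [cdist]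
  have htn : t < n := by omega
  have hval : (t : ZMod n).val = t := ZMod.val_natCast_of_lt htn
  have hne : (t : ZMod n) ≠ 0 := by
    intro h; rw [h, ZMod.val_zero] at hval; omega
  rw [cdist, ZMod.neg_val, if_neg hne, hval]
  exact min_eq_left (by omega)

/-- **`|x − (x + te_i)|_∞ = t`** for `2t ≤ sitesPerDir j` (the segment is the short way round). [cite: Balaban1984PropagatorsI, (1.7) p.18] -/
theorem supDist_runSite_eq (x : Balaban1983to89.Site P j) (i : Fin P.d) {t : ℕ} (ht : 2 * t ≤ P.sitesPerDir j) : supDist x (runSite x i t) = t := by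
  refine le_antisymm (supDist_runSite_le x i t) ?_
  have h1 : cdist (x i - runSite x i t i) = t := by
    rw [runSite_apply_self, sub_add_cancel_left, cdist_neg]
    exact cdist_natCast_of_two_mul_le ht
  have h2 := cdist_le_supDist x (runSite x i t) i
  rwa [h1] at h2

variable [GaugeGroup G]

/-- **GAUGE COVARIANCE OF THE SEGMENT TRANSPORT**: `U^h([x, x+te_i]) = h(x)·U([x, x+te_i])·h(x+te_i)⁻¹`.
[cite: Balaban1985Averaging, (8)–(9) p.18] -/
theorem axisHol_gaugeAct (h : GaugeTransf P j G) (U : GaugeField P j G) (i : Fin P.d) (t : ℕ) (x : Balaban1983to89.Site P j) :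
    axisHol (GaugeField.gaugeAct h U) i t x = h x * axisHol U i t x * (h (runSite x i t))⁻¹ := by
  induction t with
  | zero => simp [axisHol]
  | succ t ih =>
    rw [axisHol_succ, axisHol_succ, ih]
    show h x * axisHol U i t x * (h (runSite x i t))⁻¹ * (h (runSite x i t) * U ⟨runSite x i t, i⟩ * (h ((runSite x i t).shift i))⁻¹) = _
    rw [runSite_succ]; group

/-- In `U(1)`: the transport read in `ℂ` is the product of the bond variables, hence `= 1` when every bond of the segment is trivial.
[cite: Balaban1985Averaging, (9) p.18] -/
theorem toC_axisHol_eq_one (U : GaugeField P j U1) (i : Fin P.d) (t : ℕ) (x : Balaban1983to89.Site P j)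
    (hU : ∀ s, s < t → cfg U ⟨runSite x i s, i⟩ = 1) : toC (axisHol U i t x) = 1 := by
  induction t with
  | zero => simp [axisHol, toC_one]
  | succ t ih =>
    rw [axisHol_succ, toC_mul, ih (fun s hs => hU s (by omega))]
    have := hU t (by omega)
    rw [cfg] at this
    rw [this, one_mul]

/-- In `U(1)`: `|U(Γ)| = 1`. [cite: Balaban1985Averaging, (9) p.18] -/
theorem norm_toC_axisHol (U : GaugeField P j U1) (i : Fin P.d) (t : ℕ) (x : Balaban1983to89.Site P j) : ‖toC (axisHol U i t x)‖ = 1 :=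
  norm_toC _

/-- **COVARIANT DERIVATIVES ARE GAUGE COVARIANT**: `(D_{u^h}(hφ))(b) = h(b₋)·(D_uφ)(b)` ((2.7) p. 303). [cite: BalabanImbrieJaffe1985, (2.7) p.303] -/
theorem covD_gaugeAct (c : ℝ) (h : GaugeTransf P j U1) (U : GaugeField P j U1) (φ : Balaban1983to89.Site P j → ℂ) (b : PBond P j) :
    covD c (cfg (GaugeField.gaugeAct h U)) (fun z => toC (h z) * φ z) b = toC (h b.src) * covD c (cfg U) φ b := by
  simp only [covD]
  have e1 : cfg (GaugeField.gaugeAct h U) b = toC (h b.src) * cfg U b * conj (toC (h b.tgt)) := by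
    show toC (h b.src * U b * (h b.tgt)⁻¹) = _
    rw [toC_mul, toC_mul, toC_inv]; rfl
  rw [e1]
  have h1 : conj (toC (h b.tgt)) * toC (h b.tgt) = 1 := conj_mul_toC _
  linear_combination (c : ℂ) * toC (h b.src) * cfg U b * φ b.tgt * h1

end Transport

/-! ## §2 The gauge-invariant Hölder estimate at an axis-parallel pair -/

section Leg

variable {P : Params}

/-- **THE HÖLDER MEMBER OF [7] (1.9) AT AN AXIS-PARALLEL PAIR, GAUGE-INVARIANT FORM** — p. 326 for p31's torus propagator of record
`G_k(T,u) = gBox (α_kL^{kd}) ε⁻¹ u k T`: for `2 ≤ d ≤ 3`, `L` odd `> 1`, `a > 0`, `0 ≤ α < 1` there are `t₀, c₀ > 0` such that, `k`-uniformly at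
small fields (`|u(∂p) − 1| ≤ θ`, `2d³(L^{2k}θ)² ≤ 1`), for every site `x`, directions `i, μ`, every `1 ≤ ρ ≤ L^k/64` and every `f` with `|f| ≤ F`
vanishing at sup-distance `< D` from `x`, with `x′ = x + ρe_i` and `Γ = [x, x′]` the straight segment (a shortest contour, `|x − x′|_∞ = ρ`):
`‖U(Γ)·(D_uG_kf)(⟨x′, μ⟩) − (D_uG_kf)(⟨x, μ⟩)‖ ≤ c₀(ρ/L^k)^α(L^kε)e^{−t₀D/L^k}F`.  Proof: in the axis-rooted gauge of file 2b the transport is `1`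
and both covariant derivatives are plain differences (`holder19_leg_gauged`); gauge covariance (`axisHol_gaugeAct`, `covD_gaugeAct`).
[cite: BalabanImbrieJaffe1985, (7.3.1) p.326; Balaban1983RegularityDecay, (1.9) p.573] -/
theorem holder19_leg (d L : ℕ) (hd : 2 ≤ d) (hd3 : d ≤ 3) (hL : Odd L ∧ 1 < L) {a : ℝ} (ha : 0 < a) {α : ℝ} (hα0 : 0 ≤ α) (hα1 : α < 1) :
    ∃ t₀ c₀ : ℝ, 0 < t₀ ∧ 0 < c₀ ∧ ∀ (P : Params), P.d = d → P.L = L →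
      ∀ k : ℕ, 1 ≤ k → k ≤ P.K → ∀ (U : GaugeField P 0 U1) (θ : ℝ),
        (∀ (y : Balaban1983to89.Site P 0) (μ ν : Fin P.d), ‖BIJ85AbelianStokes.plaqC U y μ ν - 1‖ ≤ θ) →
        2 * (P.d : ℝ) ^ 3 * (((P.L : ℝ) ^ k) ^ 2 * θ) ^ 2 ≤ 1 →
        ∀ (x : Balaban1983to89.Site P 0) (i μ : Fin P.d) (ρ : ℕ), 1 ≤ ρ → 64 * ρ ≤ P.L ^ k →
        ∀ (f : Balaban1983to89.Site P 0 → ℂ) (F D : ℝ),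
          (∀ z, ‖f z‖ ≤ F) → (∀ z, f z ≠ 0 → D ≤ (supDist x z : ℝ)) →
          ‖toC (axisHol U i ρ x) *
                covD P.eps⁻¹ (cfg U) (gBox (B1RG242Torus.α P a k * (P.L : ℝ) ^ (k * P.d)) P.eps⁻¹ U k univ *ᵥ f) ⟨runSite x i ρ, μ⟩ -
              covD P.eps⁻¹ (cfg U) (gBox (B1RG242Torus.α P a k * (P.L : ℝ) ^ (k * P.d)) P.eps⁻¹ U k univ *ᵥ f) ⟨x, μ⟩‖
            ≤ c₀ * ((ρ : ℝ) / (P.L : ℝ) ^ k) ^ α * P.spacing k * Real.exp (-(t₀ * D / (P.L : ℝ) ^ k)) * F := by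
  obtain ⟨t₀, c₀, ht₀, hc₀, hleg⟩ := holder19_leg_gauged d L hd hd3 hL ha hα0 hα1
  refine ⟨t₀, c₀, ht₀, hc₀, ?_⟩
  intro P hPd hPL k hk1 hkK U θ hθ hsmall x i μ ρ hρ1 hρ64 f F D hF hsupp
  have hk : k ≤ P.m + P.K := hkK.trans (Nat.le_add_left _ _)
  have hN : 2 * P.L ^ k ≤ P.sitesPerDir 0 := BIJ85ScalarPropagatorSupDecayDeriv.two_mul_pow_le_sitesPerDir hk
  set x₁ := runSite x i ρ with hx₁
  have hax : ∀ ν, ν ≠ i → x₁ ν = x ν := fun ν hν => runSite_apply_ne x hν ρ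
  have hdist : supDist x x₁ = ρ := supDist_runSite_eq x i (by omega)
  have h1 : 1 ≤ supDist x x₁ := by rw [hdist]; exact hρ1
  have h64 : 64 * supDist x x₁ ≤ P.L ^ k := by rw [hdist]; exact hρ64
  obtain ⟨haxis, hest⟩ := hleg P hPd hPL k hk1 hkK U θ hθ hsmall x x₁ i μ hax h1 h64 f F D hF hsupp
  rw [hdist] at hest
  set hg := BIJ85BiCentredAxialGauge.centredGaugeDir U x (2 * (P.L ^ k / 8)) i with hhg
  set φ := gBox (B1RG242Torus.α P a k * (P.L : ℝ) ^ (k * P.d)) P.eps⁻¹ U k univ *ᵥ f with hφ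
  set U' := GaugeField.gaugeAct hg U with hU'
  set ψ : Balaban1983to89.Site P 0 → ℂ := fun z => toC (hg z) * φ z with hψ
  -- the transport and the two bond variables are trivial in the gauge
  have hseg : ∀ s, s < ρ → cfg U' ⟨runSite x i s, i⟩ = 1 := fun s hs =>
    haxis (runSite x i s) i (fun ν hν => runSite_apply_ne x hν s) (by rw [hdist]; exact (supDist_runSite_le x i s).trans hs.le)
  have hA' : toC (axisHol U' i ρ x) = 1 := toC_axisHol_eq_one U' i ρ x hseg
  have hu0 : cfg U' ⟨x, μ⟩ = 1 := haxis x μ (fun _ _ => rfl) (by rw [(supDist_eq_zero_iff x x).2 rfl]; exact Nat.zero_le _)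
  have hu1 : cfg U' ⟨x₁, μ⟩ = 1 := haxis x₁ μ hax le_rfl
  -- gauge covariance of the three factors
  have hAg : toC (axisHol U' i ρ x) = toC (hg x) * toC (axisHol U i ρ x) * conj (toC (hg x₁)) := by
    rw [hU', axisHol_gaugeAct, toC_mul, toC_mul, toC_inv]
  have hD0 : covD P.eps⁻¹ (cfg U') ψ ⟨x, μ⟩ = toC (hg x) * covD P.eps⁻¹ (cfg U) φ ⟨x, μ⟩ := covD_gaugeAct _ hg U φ _
  have hD1 : covD P.eps⁻¹ (cfg U') ψ ⟨x₁, μ⟩ = toC (hg x₁) * covD P.eps⁻¹ (cfg U) φ ⟨x₁, μ⟩ := covD_gaugeAct _ hg U φ _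
  -- the invariant quantity in the gauge
  have hkey : toC (hg x) * (toC (axisHol U i ρ x) * covD P.eps⁻¹ (cfg U) φ ⟨x₁, μ⟩ - covD P.eps⁻¹ (cfg U) φ ⟨x, μ⟩) =
      toC (axisHol U' i ρ x) * covD P.eps⁻¹ (cfg U') ψ ⟨x₁, μ⟩ - covD P.eps⁻¹ (cfg U') ψ ⟨x, μ⟩ := by
    rw [hAg, hD0, hD1]
    have h1 : conj (toC (hg x₁)) * toC (hg x₁) = 1 := conj_mul_toC _
    linear_combination (-(toC (hg x) * toC (axisHol U i ρ x) * covD P.eps⁻¹ (cfg U) φ ⟨x₁, μ⟩)) * h1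
  -- in the gauge: plain second difference divided by `ε`
  have hgauged : toC (axisHol U' i ρ x) * covD P.eps⁻¹ (cfg U') ψ ⟨x₁, μ⟩ - covD P.eps⁻¹ (cfg U') ψ ⟨x, μ⟩ =
      ((P.eps⁻¹ : ℝ) : ℂ) * ((ψ (x₁.shift μ) - ψ x₁) - (ψ (x.shift μ) - ψ x)) := by
    rw [hA', one_mul]
    simp only [covD, hu0, hu1, one_mul]
    show ((P.eps⁻¹ : ℝ) : ℂ) * (ψ (x₁.shift μ) - ψ x₁) - ((P.eps⁻¹ : ℝ) : ℂ) * (ψ (x.shift μ) - ψ x) = _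
    ring
  have hnorm : ‖toC (axisHol U i ρ x) * covD P.eps⁻¹ (cfg U) φ ⟨x₁, μ⟩ - covD P.eps⁻¹ (cfg U) φ ⟨x, μ⟩‖ =
      P.eps⁻¹ * ‖(ψ (x₁.shift μ) - ψ x₁) - (ψ (x.shift μ) - ψ x)‖ := by
    have h1 : ‖toC (hg x) * (toC (axisHol U i ρ x) * covD P.eps⁻¹ (cfg U) φ ⟨x₁, μ⟩ - covD P.eps⁻¹ (cfg U) φ ⟨x, μ⟩)‖ =
        ‖toC (axisHol U i ρ x) * covD P.eps⁻¹ (cfg U) φ ⟨x₁, μ⟩ - covD P.eps⁻¹ (cfg U) φ ⟨x, μ⟩‖ := by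
      rw [norm_mul, norm_toC, one_mul]
    rw [← h1, hkey, hgauged, norm_mul, Complex.norm_real, Real.norm_of_nonneg (inv_nonneg.2 P.eps_pos.le)]
  rw [hnorm]
  have hε : 0 < P.eps := P.eps_pos
  calc P.eps⁻¹ * ‖(ψ (x₁.shift μ) - ψ x₁) - (ψ (x.shift μ) - ψ x)‖
      ≤ P.eps⁻¹ * (c₀ * ((ρ : ℝ) / (P.L : ℝ) ^ k) ^ α * P.spacing k * P.eps * Real.exp (-(t₀ * D / (P.L : ℝ) ^ k)) * F) :=
        mul_le_mul_of_nonneg_left hest (inv_nonneg.2 hε.le)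
    _ = c₀ * ((ρ : ℝ) / (P.L : ℝ) ^ k) ^ α * P.spacing k * Real.exp (-(t₀ * D / (P.L : ℝ) ^ k)) * F := by field_simp

end Leg

/-! ## §3 The shortest staircase contour `Γ_{x,x′}` and its transport -/

section Stair

variable {P : Params} {j : ℕ}

/-- The `m`-th corner of the staircase from `x₀` to `x₁`: the coordinates `< m` are already those of `x₁`, the others still those of `x₀`
(`stairPt 0 = x₀`, `stairPt d = x₁`; B5 (1.7) *"Γ_{y,x} = [y, (y₁,…,y_{d−1},x_d)] ∪ … ∪ [(y₁,x₂,…,x_d), x]"* up to the order of the axes).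
[cite: Balaban1984PropagatorsI, (1.7) p.18; Balaban1983RegularityDecay, (1.9) p.573] -/
def stairPt (x₀ x₁ : Balaban1983to89.Site P j) (m : ℕ) : Balaban1983to89.Site P j := fun κ => if κ.val < m then x₁ κ else x₀ κ

/-- kernel: `stairPt 0 = x₀`. [cite: Balaban1984PropagatorsI, (1.7) p.18] -/
theorem stairPt_zero (x₀ x₁ : Balaban1983to89.Site P j) : stairPt x₀ x₁ 0 = x₀ := by
  funext κ; simp [stairPt]

/-- kernel: `stairPt m = x₁` for `m ≥ d`. [cite: Balaban1984PropagatorsI, (1.7) p.18] -/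
theorem stairPt_of_le (x₀ x₁ : Balaban1983to89.Site P j) {m : ℕ} (hm : P.d ≤ m) : stairPt x₀ x₁ m = x₁ := by
  funext κ; simp [stairPt, lt_of_lt_of_le κ.isLt hm]

/-- kernel: consecutive corners agree off the coordinate `m`. [cite: Balaban1984PropagatorsI, (1.7) p.18] -/
theorem stairPt_succ_apply_ne (x₀ x₁ : Balaban1983to89.Site P j) {m : ℕ} {κ : Fin P.d} (hκ : κ.val ≠ m) :
    stairPt x₀ x₁ (m + 1) κ = stairPt x₀ x₁ m κ := by
  simp only [stairPt]
  by_cases h : κ.val < m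
  · rw [if_pos h, if_pos (by omega)]
  · rw [if_neg h, if_neg (by omega)]

/-- kernel: every corner is within `|x₀ − x₁|_∞` of `x₀`. [cite: Balaban1984PropagatorsI, (1.7) p.18] -/
theorem supDist_stairPt_le (x₀ x₁ : Balaban1983to89.Site P j) (m : ℕ) : supDist x₀ (stairPt x₀ x₁ m) ≤ supDist x₀ x₁ := by
  rw [supDist_eq_sup_cdist, supDist_eq_sup_cdist]
  refine Finset.sup_le fun κ _ => ?_
  simp only [stairPt]
  split_ifs
  · exact Finset.le_sup (f := fun ν => cdist (x₀ ν - x₁ ν)) (Finset.mem_univ κ)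
  · rw [sub_self]; simp [cdist]

/-- kernel: … and within `|x₀ − x₁|_∞` of `x₁`. [cite: Balaban1984PropagatorsI, (1.7) p.18] -/
theorem supDist_stairPt_le' (x₀ x₁ : Balaban1983to89.Site P j) (m : ℕ) : supDist x₁ (stairPt x₀ x₁ m) ≤ supDist x₀ x₁ := by
  rw [supDist_eq_sup_cdist, supDist_comm, supDist_eq_sup_cdist]
  refine Finset.sup_le fun κ _ => ?_
  simp only [stairPt]
  split_ifs
  · rw [sub_self]; simp [cdist]
  · exact Finset.le_sup (f := fun ν => cdist (x₁ ν - x₀ ν)) (Finset.mem_univ κ)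

/-- kernel: the forward leg — `stairPt (m+1) = stairPt m + s_f·e_m` with `s_f = val(x₁,m − x₀,m)`. [cite: Balaban1984PropagatorsI, (1.7) p.18] -/
theorem stairPt_succ_eq_runSite (x₀ x₁ : Balaban1983to89.Site P j) (m : Fin P.d) :
    stairPt x₀ x₁ (m.val + 1) = runSite (stairPt x₀ x₁ m.val) m (x₁ m - x₀ m).val := by
  funext κ
  by_cases hκ : κ = m
  · subst hκ
    rw [runSite_apply_self]
    simp only [stairPt, lt_irrefl, if_false, Nat.lt_succ_self, if_true]
    rw [ZMod.natCast_zmod_val]; ring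
  · rw [runSite_apply_ne _ hκ, stairPt_succ_apply_ne _ _ (fun h => hκ (Fin.ext h))]

/-- kernel: the backward leg — `stairPt m = stairPt (m+1) + s_b·e_m` with `s_b = val(x₀,m − x₁,m)`. [cite: Balaban1984PropagatorsI, (1.7) p.18] -/
theorem stairPt_eq_runSite_succ (x₀ x₁ : Balaban1983to89.Site P j) (m : Fin P.d) :
    stairPt x₀ x₁ m.val = runSite (stairPt x₀ x₁ (m.val + 1)) m (x₀ m - x₁ m).val := by
  funext κ
  by_cases hκ : κ = m
  · subst hκ
    rw [runSite_apply_self]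
    simp only [stairPt, lt_irrefl, if_false, Nat.lt_succ_self, if_true]
    rw [ZMod.natCast_zmod_val]; ring
  · rw [runSite_apply_ne _ hκ, stairPt_succ_apply_ne _ _ (fun h => hκ (Fin.ext h))]

/-- kernel: the two step counts of a leg are the two residues, the short one is the circular distance `≤ |x₀ − x₁|_∞`.
[cite: Balaban1984PropagatorsI, (1.7) p.18] -/
theorem min_val_le_supDist (x₀ x₁ : Balaban1983to89.Site P j) (m : Fin P.d) :
    min (x₁ m - x₀ m).val (x₀ m - x₁ m).val ≤ supDist x₀ x₁ := by
  have h := cdist_le_supDist x₁ x₀ m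
  rw [supDist_comm] at h
  have e : cdist (x₁ m - x₀ m) = min (x₁ m - x₀ m).val (x₀ m - x₁ m).val := by rw [cdist, neg_sub]
  rw [← e]; exact h

open Classical in
/-- THE TRANSPORT OF THE `m`-TH LEG of the staircase, the short way round: forward `U([w, w + s_fe_m])` if `s_f ≤ s_b`, else the inverse
(conjugate) of `U([w′, w′ + s_be_m])`; `1` for `m ≥ d`. [cite: Balaban1983RegularityDecay, (1.9) p.573] -/
def legHol (U : GaugeField P j U1) (x₀ x₁ : Balaban1983to89.Site P j) (m : ℕ) : ℂ :=
  if h : m < P.d then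
    (if (x₁ ⟨m, h⟩ - x₀ ⟨m, h⟩).val ≤ (x₀ ⟨m, h⟩ - x₁ ⟨m, h⟩).val then
      toC (axisHol U ⟨m, h⟩ (x₁ ⟨m, h⟩ - x₀ ⟨m, h⟩).val (stairPt x₀ x₁ m))
    else conj (toC (axisHol U ⟨m, h⟩ (x₀ ⟨m, h⟩ - x₁ ⟨m, h⟩).val (stairPt x₀ x₁ (m + 1)))))
  else 1

/-- **THE TRANSPORT `U(Γ_{x₀,x₁})` ALONG THE SHORTEST STAIRCASE CONTOUR** (product of the leg transports; `U(1)` is abelian).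
[cite: Balaban1983RegularityDecay, (1.9) p.573] -/
def stairHol (U : GaugeField P j U1) (x₀ x₁ : Balaban1983to89.Site P j) : ℂ := ∏ m ∈ Finset.range P.d, legHol U x₀ x₁ m

/-- kernel: `|legHol| = 1`. [cite: Balaban1985Averaging, (9) p.18] -/
theorem norm_legHol (U : GaugeField P j U1) (x₀ x₁ : Balaban1983to89.Site P j) (m : ℕ) : ‖legHol U x₀ x₁ m‖ = 1 := by
  unfold legHol
  split_ifs
  · exact norm_toC _
  · rw [Complex.norm_conj]; exact norm_toC _
  · exact norm_one

/-- kernel: `|Π_{l<m} legHol l| = 1`. [cite: Balaban1985Averaging, (9) p.18] -/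
theorem norm_prod_legHol (U : GaugeField P j U1) (x₀ x₁ : Balaban1983to89.Site P j) (m : ℕ) :
    ‖∏ l ∈ Finset.range m, legHol U x₀ x₁ l‖ = 1 := by
  rw [norm_prod]; exact Finset.prod_eq_one fun l _ => norm_legHol U x₀ x₁ l

/-- kernel: `|U(Γ_{x₀,x₁})| = 1`. [cite: Balaban1985Averaging, (9) p.18] -/
theorem norm_stairHol (U : GaugeField P j U1) (x₀ x₁ : Balaban1983to89.Site P j) : ‖stairHol U x₀ x₁‖ = 1 := norm_prod_legHol U x₀ x₁ P.d

/-- **TELESCOPING ALONG THE STAIRCASE**: for any bond function `X`,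
`‖(Π_{l<m} c_l)·X(w_m) − X(w_0)‖ ≤ Σ_{l<m} ‖c_l·X(w_{l+1}) − X(w_l)‖` (`|c_l| = 1`). [cite: Balaban1983RegularityDecay, (1.9) p.573] -/
theorem stair_telescope (U : GaugeField P j U1) (x₀ x₁ : Balaban1983to89.Site P j) (X : Balaban1983to89.Site P j → ℂ) (m : ℕ) :
    ‖(∏ l ∈ Finset.range m, legHol U x₀ x₁ l) * X (stairPt x₀ x₁ m) - X (stairPt x₀ x₁ 0)‖ ≤
      ∑ l ∈ Finset.range m, ‖legHol U x₀ x₁ l * X (stairPt x₀ x₁ (l + 1)) - X (stairPt x₀ x₁ l)‖ := by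
  induction m with
  | zero => simp
  | succ m ih =>
    rw [Finset.prod_range_succ, Finset.sum_range_succ]
    have e : (∏ l ∈ Finset.range m, legHol U x₀ x₁ l) * legHol U x₀ x₁ m * X (stairPt x₀ x₁ (m + 1)) - X (stairPt x₀ x₁ 0) =
        (∏ l ∈ Finset.range m, legHol U x₀ x₁ l) * (legHol U x₀ x₁ m * X (stairPt x₀ x₁ (m + 1)) - X (stairPt x₀ x₁ m)) +
          ((∏ l ∈ Finset.range m, legHol U x₀ x₁ l) * X (stairPt x₀ x₁ m) - X (stairPt x₀ x₁ 0)) := by ring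
    rw [e]
    refine (norm_add_le _ _).trans ?_
    rw [norm_mul, norm_prod_legHol, one_mul]
    linarith

end Stair

/-! ## §4 p. 326: THE HÖLDER MEMBER OF [7] (1.9) FOR `G_k(u)` AT SMALL NON-FLAT FIELDS — all pairs, `k`-uniform -/

section Main

variable {P : Params}

set_option maxHeartbeats 400000 in
/-- **p. 326: THE HÖLDER MEMBER OF [Balaban1983RegularityDecay] (1.9) FOR THE COVARIANT DERIVATIVE OF THE BLOCK PROPAGATOR `G_k(u)` AT SMALL
NON-FLAT FIELDS, `k`-UNIFORM, ALL PAIRS** — for [BalabanImbrieJaffe1985] p. 326 *"The propagators arising from Δ_k(u_k), under the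
restriction (7.3.1) on the gauge field, also satisfy the regularity and decay estimates of [7]"* and (1.9)
*"|x−x′|^{−α}|U(A(Γ_{x,x′}))(D^η_{A,μ}G_k(Ω,A)f)(x′) − (D^η_{A,μ}G_k(Ω,A)f)(x)| ≤ c₀exp(−δ₀dist({x,x′},supp f))‖f‖_∞"*, for p31's torus
propagator of record `G_k(T,u) = gBox (α_kL^{kd}) ε⁻¹ u k T` under the hypotheses of the value member
(`BIJ85ScalarPropagatorSupDecay.decay110_smallField`): for `2 ≤ d ≤ 3`, `L` odd `> 1`, `a > 0`, `0 ≤ α < 1` there are `t₀, c₀ > 0` (on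
`d, L, a, α`) such that for every volume, every `1 ≤ k ≤ K`, every `U(1)` field with `|u(∂p) − 1| ≤ θ`, `2d³(L^{2k}θ)² ≤ 1`, every pair of
distinct sites `x, x′`, every direction `μ` and every `f` with `|f| ≤ F` vanishing at sup-distance `< D` from the pair `{x, x′}`:
`(L^k/|x−x′|_∞)^α·‖U(Γ_{x,x′})(D_uG_kf)(⟨x′,μ⟩) − (D_uG_kf)(⟨x,μ⟩)‖ ≤ c₀(L^kε)e^{−t₀D/L^k}F`, `Γ_{x,x′}` the shortest staircase contour
(`stairHol`) — ONE power of the block spacing as in the `D_u` member.  Near pairs (`64|x−x′|_∞ ≤ L^k`): `d` axis-parallel legs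
(`holder19_leg`, each `≤ |x−x′|_∞` long, each corner within `|x−x′|_∞` of `x`) telescoped (`stair_telescope`); far pairs: the `D_u` member
`BIJ85ScalarPropagatorSupDecayDeriv.decay110_smallField_deriv` at both bonds.
[cite: BalabanImbrieJaffe1985, (7.3.1) p.326; Balaban1983RegularityDecay, (1.9) p.573] -/
theorem holder19_smallField (d L : ℕ) (hd : 2 ≤ d) (hd3 : d ≤ 3) (hL : Odd L ∧ 1 < L) {a : ℝ} (ha : 0 < a) {α : ℝ} (hα0 : 0 ≤ α)
    (hα1 : α < 1) :
    ∃ t₀ c₀ : ℝ, 0 < t₀ ∧ 0 < c₀ ∧ ∀ (P : Params), P.d = d → P.L = L →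
      ∀ k : ℕ, 1 ≤ k → k ≤ P.K → ∀ (U : GaugeField P 0 U1) (θ : ℝ),
        (∀ (y : Balaban1983to89.Site P 0) (μ ν : Fin P.d), ‖BIJ85AbelianStokes.plaqC U y μ ν - 1‖ ≤ θ) →
        2 * (P.d : ℝ) ^ 3 * (((P.L : ℝ) ^ k) ^ 2 * θ) ^ 2 ≤ 1 →
        ∀ (x₀ x₁ : Balaban1983to89.Site P 0) (μ : Fin P.d), x₀ ≠ x₁ →
        ∀ (f : Balaban1983to89.Site P 0 → ℂ) (F D : ℝ),
          (∀ z, ‖f z‖ ≤ F) → (∀ z, f z ≠ 0 → D ≤ (supDist x₀ z : ℝ) ∧ D ≤ (supDist x₁ z : ℝ)) →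
          (((P.L : ℝ) ^ k / (supDist x₀ x₁ : ℝ)) ^ α *
            ‖stairHol U x₀ x₁ *
                covD P.eps⁻¹ (cfg U) (gBox (B1RG242Torus.α P a k * (P.L : ℝ) ^ (k * P.d)) P.eps⁻¹ U k univ *ᵥ f) ⟨x₁, μ⟩ -
              covD P.eps⁻¹ (cfg U) (gBox (B1RG242Torus.α P a k * (P.L : ℝ) ^ (k * P.d)) P.eps⁻¹ U k univ *ᵥ f) ⟨x₀, μ⟩‖
            ≤ c₀ * P.spacing k * Real.exp (-(t₀ * D / (P.L : ℝ) ^ k)) * F) := by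
  classical
  obtain ⟨t₁, c₁, ht₁, hc₁, hleg⟩ := holder19_leg d L hd hd3 hL ha hα0 hα1
  obtain ⟨t₂, c₂, ht₂, hc₂, hder⟩ := BIJ85ScalarPropagatorSupDecayDeriv.decay110_smallField_deriv d L hd hd3 hL ha
  set t : ℝ := min t₁ t₂ with htdef
  have ht : 0 < t := lt_min ht₁ ht₂
  have htt₁ : t ≤ t₁ := min_le_left _ _
  have htt₂ : t ≤ t₂ := min_le_right _ _
  set K : ℝ := d * (c₁ * Real.exp t₁) + 128 * c₂ with hKdef
  refine ⟨t, K + 1, ht, by positivity, ?_⟩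
  intro P hPd hPL k hk1 hkK U θ hθ hsmall x₀ x₁ μ hne f F D hF hsupp
  have hlegP := hleg P hPd hPL k hk1 hkK U θ hθ hsmall
  have hderP := hder P hPd hPL k hk1 hkK U θ hθ hsmall
  subst hPd
  -- basic quantities
  have hLpos : (0 : ℝ) < P.L := P.cast_L_pos
  set n : ℝ := (P.L : ℝ) ^ k with hndef
  have hn : 0 < n := pow_pos hLpos k
  have hnnat : ((P.L ^ k : ℕ) : ℝ) = n := by push_cast; rw [hndef]
  have hsp0 : 0 < P.spacing k := P.spacing_pos k
  have hε : 0 < P.eps := P.eps_pos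
  have hF0 : 0 ≤ F := (norm_nonneg _).trans (hF x₀)
  set ρ : ℕ := supDist x₀ x₁ with hρdef
  have hρ1 : 1 ≤ ρ := by
    by_contra h
    push Not at h
    exact hne ((supDist_eq_zero_iff x₀ x₁).1 (by omega))
  have hρ0 : (0 : ℝ) < ρ := by exact_mod_cast hρ1
  set φ := gBox (B1RG242Torus.α P a k * (P.L : ℝ) ^ (k * P.d)) P.eps⁻¹ U k univ *ᵥ f with hφ
  set X : Balaban1983to89.Site P 0 → ℂ := fun w => covD P.eps⁻¹ (cfg U) φ ⟨w, μ⟩ with hX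
  set E : ℝ := Real.exp (-(t * D / n)) with hEdef
  have hE0 : 0 < E := Real.exp_pos _
  have hexp_t : ∀ {s D' : ℝ}, t ≤ s → D ≤ D' → 0 ≤ D' → Real.exp (-(s * D' / n)) ≤ E := by
    intro s D' hs hD hD'
    rw [hEdef]; refine Real.exp_le_exp.2 ?_
    rw [neg_le_neg_iff]
    exact div_le_div_of_nonneg_right ((mul_le_mul_of_nonneg_left hD ht.le).trans (mul_le_mul_of_nonneg_right hs hD')) hn.le
  -- the unit `W = (ρ/n)^α`
  set W : ℝ := ((ρ : ℝ) / n) ^ α with hWdef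
  have hW0 : 0 < W := Real.rpow_pos_of_pos (div_pos hρ0 hn) α
  have hWinv : (n / (ρ : ℝ)) ^ α * W = 1 := by
    rw [hWdef, ← Real.mul_rpow (by positivity) (by positivity), div_mul_div_comm, mul_comm n, div_self (by positivity), Real.one_rpow]
  have hK0 : 0 ≤ K := by positivity
  -- it suffices to bound the norm by `K·W·sp·E·F`
  suffices hmain : ‖stairHol U x₀ x₁ * X x₁ - X x₀‖ ≤ K * W * P.spacing k * E * F by
    have h1 : (n / (ρ : ℝ)) ^ α * ‖stairHol U x₀ x₁ * X x₁ - X x₀‖ ≤ (n / (ρ : ℝ)) ^ α * (K * W * P.spacing k * E * F) :=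
      mul_le_mul_of_nonneg_left hmain (Real.rpow_nonneg (by positivity) α)
    have h2 : (n / (ρ : ℝ)) ^ α * (K * W * P.spacing k * E * F) = K * P.spacing k * E * F := by
      calc (n / (ρ : ℝ)) ^ α * (K * W * P.spacing k * E * F) = ((n / (ρ : ℝ)) ^ α * W) * (K * P.spacing k * E * F) := by ring
        _ = K * P.spacing k * E * F := by rw [hWinv, one_mul]
    have h3 : K * P.spacing k * E * F ≤ (K + 1) * P.spacing k * E * F := by
      have : 0 ≤ P.spacing k * E * F := by positivity
      nlinarith
    simpa [hX, hρdef, hEdef, hndef] using (h1.trans (h2.le.trans h3))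
  by_cases hfar : P.L ^ k < 64 * ρ
  · ----------------------------------------------------------------------------------------------------------------
    -- FAR PAIRS: the `D_u` member at both bonds
    have hX0 : ‖X x₀‖ ≤ c₂ * P.spacing k * E * F := by
      have h := hderP x₀ μ f F (max D 0) hF (fun z hz => max_le (hsupp z hz).1 (Nat.cast_nonneg _))
      refine h.trans ?_
      have : Real.exp (-(t₂ * max D 0 / n)) ≤ E := hexp_t htt₂ (le_max_left _ _) (le_max_right _ _)
      gcongr
    have hX1 : ‖X x₁‖ ≤ c₂ * P.spacing k * E * F := by
      have h := hderP x₁ μ f F (max D 0) hF (fun z hz => max_le (hsupp z hz).2 (Nat.cast_nonneg _))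
      refine h.trans ?_
      have : Real.exp (-(t₂ * max D 0 / n)) ≤ E := hexp_t htt₂ (le_max_left _ _) (le_max_right _ _)
      gcongr
    have hW64 : 1 ≤ 64 * W := by
      have h1 : (1 : ℝ) / 64 ≤ (ρ : ℝ) / n := by
        rw [div_le_div_iff₀ (by norm_num) hn]
        have : ((P.L ^ k : ℕ) : ℝ) ≤ ((64 * ρ : ℕ) : ℝ) := by exact_mod_cast hfar.le
        rw [hnnat] at this; push_cast at this; linarith
      have h2 : ((1 : ℝ) / 64) ^ α ≤ W := Real.rpow_le_rpow (by norm_num) h1 hα0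
      have h3 : (1 : ℝ) / 64 ≤ ((1 : ℝ) / 64) ^ α := by
        have := Real.rpow_le_rpow_of_exponent_ge (by norm_num : (0 : ℝ) < 1 / 64) (by norm_num : (1 : ℝ) / 64 ≤ 1) hα1.le
        rwa [Real.rpow_one] at this
      linarith
    calc ‖stairHol U x₀ x₁ * X x₁ - X x₀‖ ≤ ‖stairHol U x₀ x₁ * X x₁‖ + ‖X x₀‖ := norm_sub_le _ _
      _ = ‖X x₁‖ + ‖X x₀‖ := by rw [norm_mul, norm_stairHol, one_mul]
      _ ≤ 2 * (c₂ * P.spacing k * E * F) := by linarith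
      _ ≤ 2 * (c₂ * P.spacing k * E * F) * (64 * W) := le_mul_of_one_le_right (by positivity) hW64
      _ = (128 * c₂) * W * P.spacing k * E * F := by ring
      _ ≤ K * W * P.spacing k * E * F := by
          have : 128 * c₂ ≤ K := by rw [hKdef]; linarith [show 0 ≤ (P.d : ℝ) * (c₁ * Real.exp t₁) by positivity]
          gcongr
  ----------------------------------------------------------------------------------------------------------------
  -- NEAR PAIRS: the staircase
  push Not at hfar
  have hρn : 64 * (ρ : ℝ) ≤ n := by rw [← hnnat]; exact_mod_cast hfar
  -- the per-leg bound
  have hlegB : ∀ l, l < P.d → ‖legHol U x₀ x₁ l * X (stairPt x₀ x₁ (l + 1)) - X (stairPt x₀ x₁ l)‖ ≤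
      (c₁ * Real.exp t₁) * W * P.spacing k * E * F := by
    intro l hl
    set m : Fin P.d := ⟨l, hl⟩ with hm
    set w := stairPt x₀ x₁ l with hw
    set w' := stairPt x₀ x₁ (l + 1) with hw'
    set sf : ℕ := (x₁ m - x₀ m).val with hsf
    set sb : ℕ := (x₀ m - x₁ m).val with hsb
    have hmin : min sf sb ≤ ρ := min_val_le_supDist x₀ x₁ m
    -- distances from the corners to the support
    have hsuppw : ∀ w₀ : Balaban1983to89.Site P 0, supDist x₀ w₀ ≤ ρ → ∀ z, f z ≠ 0 → max (D - ρ) 0 ≤ (supDist w₀ z : ℝ) := by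
      intro w₀ hw₀ z hz
      refine max_le ?_ (Nat.cast_nonneg _)
      have h1 := (hsupp z hz).1
      have h2 := supDist_triangle x₀ w₀ z
      have h3 : ((supDist x₀ z : ℕ) : ℝ) ≤ ((supDist x₀ w₀ + supDist w₀ z : ℕ) : ℝ) := by exact_mod_cast h2
      have h4 : ((supDist x₀ w₀ : ℕ) : ℝ) ≤ ρ := by exact_mod_cast hw₀
      push_cast at h3; linarith
    have hEρ : Real.exp (-(t₁ * max (D - ρ) 0 / n)) ≤ Real.exp t₁ * E := by
      rw [hEdef, ← Real.exp_add]
      refine Real.exp_le_exp.2 ?_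
      have hD'' : 0 ≤ max (D - (ρ : ℝ)) 0 := le_max_right _ _
      have h1 : t * max (D - ρ) 0 ≤ t₁ * max (D - ρ) 0 := mul_le_mul_of_nonneg_right htt₁ hD''
      have h2 : t * (D - ρ) ≤ t * max (D - ρ) 0 := mul_le_mul_of_nonneg_left (le_max_left _ _) ht.le
      have h3 : t * (ρ : ℝ) / n ≤ t₁ := by
        rw [div_le_iff₀ hn]
        calc t * (ρ : ℝ) ≤ t * n := mul_le_mul_of_nonneg_left (by linarith) ht.le
          _ ≤ t₁ * n := mul_le_mul_of_nonneg_right htt₁ hn.le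
      have h4 : (t * D - t * ρ) / n ≤ t₁ * max (D - ρ) 0 / n := div_le_div_of_nonneg_right (by linarith) hn.le
      have h5 : (t * D - t * ρ) / n = t * D / n - t * ρ / n := by ring
      rw [h5] at h4
      linarith
    have hsα : ∀ {s : ℕ}, s ≤ ρ → ((s : ℝ) / n) ^ α ≤ W := fun {s} hs =>
      Real.rpow_le_rpow (by positivity) (div_le_div_of_nonneg_right (by exact_mod_cast hs) hn.le) hα0
    by_cases hcase : sf ≤ sb
    · -- forward leg (or trivial leg)
      have hlegdef : legHol U x₀ x₁ l = toC (axisHol U m sf w) := by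
        rw [legHol, dif_pos hl]; simp only [← hm, ← hsf, ← hsb, if_pos hcase, hw]
      have hw'eq : w' = runSite w m sf := by rw [hw', hw, hsf, hm]; exact stairPt_succ_eq_runSite x₀ x₁ ⟨l, hl⟩
      rcases Nat.eq_zero_or_pos sf with h0 | hpos
      · -- trivial leg
        have : w' = w := by rw [hw'eq, h0, runSite_zero]
        rw [hlegdef, h0, axisHol_zero, toC_one, one_mul, this, sub_self, norm_zero]; positivity
      · have hsfρ : sf ≤ ρ := by rw [min_eq_left hcase] at hmin; exact hmin
        have h := hlegP w m μ sf hpos (by omega) f F (max (D - ρ) 0) hF (hsuppw w (supDist_stairPt_le x₀ x₁ l))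
        rw [← hw'eq] at h
        rw [hlegdef]
        refine h.trans ?_
        calc c₁ * ((sf : ℝ) / (P.L : ℝ) ^ k) ^ α * P.spacing k * Real.exp (-(t₁ * max (D - ρ) 0 / (P.L : ℝ) ^ k)) * F
            ≤ c₁ * W * P.spacing k * (Real.exp t₁ * E) * F := by rw [← hndef]; gcongr; exact hsα hsfρ
          _ = (c₁ * Real.exp t₁) * W * P.spacing k * E * F := by ring
    · -- backward leg
      push Not at hcase
      have hlegdef : legHol U x₀ x₁ l = conj (toC (axisHol U m sb w')) := by
        rw [legHol, dif_pos hl]; simp only [← hm, ← hsf, ← hsb, if_neg (not_le.2 hcase), hw']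
      have hweq : w = runSite w' m sb := by rw [hw', hw, hsb, hm]; exact stairPt_eq_runSite_succ x₀ x₁ ⟨l, hl⟩
      have hsbρ : sb ≤ ρ := by rw [min_eq_right hcase.le] at hmin; exact hmin
      have hsbpos : 0 < sb := by
        rcases Nat.eq_zero_or_pos sb with h0 | h
        · exfalso
          have hz : x₀ m - x₁ m = 0 := (ZMod.val_eq_zero _).1 h0
          have hsf0 : sf = 0 := by rw [hsf, show x₁ m - x₀ m = 0 by rw [← neg_sub, hz, neg_zero], ZMod.val_zero]
          omega
        · exact h
      have h := hlegP w' m μ sb hsbpos (by omega) f F (max (D - ρ) 0) hF (hsuppw w' (supDist_stairPt_le x₀ x₁ (l + 1)))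
      rw [← hweq] at h
      -- `‖conj(a)·X(w′) − X(w)‖ = ‖a·X(w) − X(w′)‖`
      have hnormeq : ‖conj (toC (axisHol U m sb w')) * X w' - X w‖ = ‖toC (axisHol U m sb w') * X w - X w'‖ := by
        set aa := toC (axisHol U m sb w') with haa
        have h1 : conj aa * aa = 1 := conj_mul_toC _
        have e : conj aa * X w' - X w = -(conj aa * (aa * X w - X w')) := by linear_combination (X w) * h1
        rw [e, norm_neg, norm_mul, Complex.norm_conj, haa, norm_toC, one_mul]
      rw [hlegdef, hnormeq]
      refine h.trans ?_
      calc c₁ * ((sb : ℝ) / (P.L : ℝ) ^ k) ^ α * P.spacing k * Real.exp (-(t₁ * max (D - ρ) 0 / (P.L : ℝ) ^ k)) * F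
          ≤ c₁ * W * P.spacing k * (Real.exp t₁ * E) * F := by rw [← hndef]; gcongr; exact hsα hsbρ
        _ = (c₁ * Real.exp t₁) * W * P.spacing k * E * F := by ring
  -- telescoping
  have htel := stair_telescope U x₀ x₁ X P.d
  rw [stairPt_zero, stairPt_of_le x₀ x₁ le_rfl] at htel
  calc ‖stairHol U x₀ x₁ * X x₁ - X x₀‖ = ‖(∏ l ∈ Finset.range P.d, legHol U x₀ x₁ l) * X x₁ - X x₀‖ := rfl
    _ ≤ ∑ l ∈ Finset.range P.d, ‖legHol U x₀ x₁ l * X (stairPt x₀ x₁ (l + 1)) - X (stairPt x₀ x₁ l)‖ := htel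
    _ ≤ ∑ _l ∈ Finset.range P.d, (c₁ * Real.exp t₁) * W * P.spacing k * E * F :=
        Finset.sum_le_sum fun l hl => hlegB l (Finset.mem_range.1 hl)
    _ = P.d * ((c₁ * Real.exp t₁) * W * P.spacing k * E * F) := by rw [Finset.sum_const, Finset.card_range, nsmul_eq_mul]
    _ = (P.d * (c₁ * Real.exp t₁)) * W * P.spacing k * E * F := by ring
    _ ≤ K * W * P.spacing k * E * F := by
        have : (P.d : ℝ) * (c₁ * Real.exp t₁) ≤ K := by rw [hKdef]; linarith [show (0 : ℝ) ≤ 128 * c₂ by positivity]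
        gcongr

/-- **THE SAME IN p31's (1.9) SHAPE** (distance `B5Ineq137Torus.T = |·−·|_∞`, rate `e^{−δ₀εD}`; `L^kε ≤ 1` for `k ≤ K`): the Hölder
companion of `BIJ85ScalarPropagatorSupDecayDeriv.decay110_smallField_deriv_T`.
[cite: BalabanImbrieJaffe1985, (7.3.1) p.326; Balaban1983RegularityDecay, (1.9) p.573] -/
theorem holder19_smallField_T (d L : ℕ) (hd : 2 ≤ d) (hd3 : d ≤ 3) (hL : Odd L ∧ 1 < L) {a : ℝ} (ha : 0 < a) {α : ℝ} (hα0 : 0 ≤ α)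
    (hα1 : α < 1) :
    ∃ δ₀ c₀ : ℝ, 0 < δ₀ ∧ 0 < c₀ ∧ ∀ (P : Params), P.d = d → P.L = L →
      ∀ k : ℕ, 1 ≤ k → k ≤ P.K → ∀ (U : GaugeField P 0 U1) (θ : ℝ),
        (∀ (y : Balaban1983to89.Site P 0) (μ ν : Fin P.d), ‖BIJ85AbelianStokes.plaqC U y μ ν - 1‖ ≤ θ) →
        2 * (P.d : ℝ) ^ 3 * (((P.L : ℝ) ^ k) ^ 2 * θ) ^ 2 ≤ 1 →
        ∀ (x₀ x₁ : Balaban1983to89.Site P 0) (μ : Fin P.d), x₀ ≠ x₁ →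
        ∀ (f : Balaban1983to89.Site P 0 → ℂ) (F D : ℝ),
          (∀ z, ‖f z‖ ≤ F) → 0 ≤ D → (∀ z, f z ≠ 0 → D ≤ B5Ineq137Torus.T P 0 x₀ z ∧ D ≤ B5Ineq137Torus.T P 0 x₁ z) →
          (((P.L : ℝ) ^ k / B5Ineq137Torus.T P 0 x₀ x₁) ^ α *
            ‖stairHol U x₀ x₁ *
                covD P.eps⁻¹ (cfg U) (gBox (B1RG242Torus.α P a k * (P.L : ℝ) ^ (k * P.d)) P.eps⁻¹ U k univ *ᵥ f) ⟨x₁, μ⟩ -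
              covD P.eps⁻¹ (cfg U) (gBox (B1RG242Torus.α P a k * (P.L : ℝ) ^ (k * P.d)) P.eps⁻¹ U k univ *ᵥ f) ⟨x₀, μ⟩‖
            ≤ c₀ * Real.exp (-(δ₀ * (P.eps * D))) * F) := by
  obtain ⟨t₀, c₀, ht₀, hc₀, hmain⟩ := holder19_smallField d L hd hd3 hL ha hα0 hα1
  refine ⟨t₀, c₀, ht₀, hc₀, fun P hPd hPL k hk1 hkK U θ hθ hsmall x₀ x₁ μ hne f F D hF hD hsupp => ?_⟩
  have h := hmain P hPd hPL k hk1 hkK U θ hθ hsmall x₀ x₁ μ hne f F D hF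
    (fun z hz => by rw [← B3Bound323ZeroTorus.T_eq_supDist, ← B3Bound323ZeroTorus.T_eq_supDist]; exact hsupp z hz)
  rw [← B3Bound323ZeroTorus.T_eq_supDist] at h
  have hF0 : 0 ≤ F := (norm_nonneg _).trans (hF x₀)
  have hsp1 : (P.L : ℝ) ^ k * P.eps ≤ 1 := B3GkZeroTorusRescaled.spacing_le_one P hkK
  have hn : 0 < (P.L : ℝ) ^ k := pow_pos P.cast_L_pos k
  have hexp : Real.exp (-(t₀ * D / (P.L : ℝ) ^ k)) ≤ Real.exp (-(t₀ * (P.eps * D))) := by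
    refine Real.exp_le_exp.2 (neg_le_neg ?_)
    rw [le_div_iff₀ hn]
    calc t₀ * (P.eps * D) * (P.L : ℝ) ^ k = t₀ * D * ((P.L : ℝ) ^ k * P.eps) := by ring
      _ ≤ t₀ * D * 1 := mul_le_mul_of_nonneg_left hsp1 (by positivity)
      _ = t₀ * D := mul_one _
  refine h.trans ?_
  have hsp : P.spacing k = (P.L : ℝ) ^ k * P.eps := rfl
  calc c₀ * P.spacing k * Real.exp (-(t₀ * D / (P.L : ℝ) ^ k)) * F ≤ c₀ * 1 * Real.exp (-(t₀ * (P.eps * D))) * F := by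
        rw [hsp]; gcongr
    _ = c₀ * Real.exp (-(t₀ * (P.eps * D))) * F := by ring

end Main

end

end Literature.MathematicalPhysics.QuantumFieldTheory.BalabanImbrieJaffe1984to88.BIJ85ScalarPropagatorHolderDecay
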